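import Summits.Ventures.Crystal3D.Theorems.StickyWulffConstantCoaxialWallLawTailResidueDefsT5
import HarnessLib

/-!
# Definitions U: the ONE-JAMMED-BALL / SEAM-RESIDUAL split of `TailResidue.MultiGrainSmallHigh` (crux `CoaxialWallLaw`, stmt-Ventures-19481;
# texts for a lane-F skeleton 'Certificates' v5; memo HOME/wall-19481-p2/F-TAIL-g10.md §10–§11, universe U-A1)

HONEST FRAMING. Venture `Summits/Ventures/Crystal3D` (cell `crystal3d-full`); DEFINITIONS (+ their bookkeeping equivalence) for the crux `CoaxialWallLaw`
(stmt-Ventures-19481, `route-Ventures-StickyWulffConstant`), registered line 'CoaxialWallLawCertificates' v4 (planner cf-p1), open stub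
`stub_multiGrainSmallHigh : KissingGap (5/2) → KissingClassification (5/2) → TailResidue.MultiGrainSmallHigh (2√6) 3`.  Nothing substantive is claimed;
F-C1 not moved.  WHY.  The high-degree seam stub mixes one STRUCTURED regime that a finite rational certificate reaches with a residue that no census
reaches (F-TAIL-g10 §10–§11):
* **U-A1 «on-site window + ONE jammed ball»**: the payer window becomes a coaxial-module pattern after removing ONE ball `x ≠ z` touching at most three
  balls.  By `…LatticeContacts` / `…ModuleContactsBarlow` a ball off the module touches `≤ 3` balls of a crystallite / Barlow window, and by `…JammedBall`
  (`localSummandA_le_of_jammed`) such a ball never reads and, when it sits at no inspected position, only LOWERS the pools of the on-site window `X.erase x`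
  by `≤ 3` near its contacts — so this regime is a re-evaluation of ON-SITE windows, i.e. a finite rational census (owner cf-p2/eng; reduction to the
  census = this lane's next file);
* **the SEAM RESIDUAL**: every other off-site, non-mono-module, high-degree payer window — bi-module junctions (U-A3; exhaustive-vacancy probes
  j329262/j330453: `S ≤ 1.25`), several dust balls, and the «dense junk» core `TailResidue.LocalBarlowRigidity` (owner 19481-p1).
The split by the shape predicate `JammedOneAt`:
* **`JammedOneAt X z`** — some `x ∈ X`, `x ≠ z`, with `#contacts(x) ≤ 3`, such that `X.erase x` is on-site for 𝒰_cx at `z`;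
* **`JammedOneSmall s k₀`** — `MultiGrainSmallHigh s k₀` restricted to windows with `JammedOneAt X z`;
* **`SeamResidual s k₀`** — `MultiGrainSmallHigh s k₀` restricted to windows with `¬ JammedOneAt X z`;
* `multiGrainSmallHigh_of_jammedOne_of_residual`, `jammedOneSmall_of_multiGrainSmallHigh`, `seamResidual_of_multiGrainSmallHigh`,
  `multiGrainSmallHigh_iff_jammedOne_and_residual` — the split is exact; both halves monotone in the line.
Proposed v5 texts: `stub_jammedOneSmall : TailResidue.JammedOneSmall (2 * Real.sqrt 6) 3` (no kissing facts needed on this shape) and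
`stub_seamResidual : KissingGap (5 / 2) → KissingClassification (5 / 2) → TailResidue.SeamResidual (2 * Real.sqrt 6) 3`; composition
`coaxialWallLaw_of_lensCertificates_jammed_split` (`…TailResidueClosingU`).
WHAT THIS IS NOT: no proof of either half; `TailResidue.LocalBarlowRigidity` is NOT claimed to imply `SeamResidual` (it yields one deficient ball within
distance `3` of the payer, not pools); F-C1 not moved.
-/

noncomputable section

namespace Summit.Ventures.Crystal3D.Theorems

namespace TailResidue

open Summit.Ventures.Crystal3D Finset
open scoped InnerProductSpace

open scoped Classical in
/-- **THE U-A1 SHAPE «on-site window + ONE jammed ball»**: some ball `x ≠ z` of `X` touching at most three balls whose removal leaves a payer window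
that is on-site for the coaxial-module universe 𝒰_cx.  (Under `¬ OnSiteAt 𝒰_cx X z` such an `x` lies within distance `3` of `z` and off the placed module.) -/
def JammedOneAt (X : Finset (EuclideanSpace ℝ (Fin 3))) (z : EuclideanSpace ℝ (Fin 3)) : Prop :=
  ∃ x ∈ X, x ≠ z ∧ (X.filter fun q => dist x q = 1).card ≤ 3 ∧ OnSiteAt coaxialModuleUniverse (X.erase x) z

open scoped Classical in
/-- **MULTI-GRAIN SMALLNESS ON THE U-A1 SHAPE**: `MultiGrainSmallHigh s k₀` restricted to payer windows with `JammedOneAt X z` — at every off-site,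
non-mono-module payer `z` with `k₀ < deg z ≤ 11` whose window is a coaxial-module pattern plus one jammed ball, a deletion of inessential balls lands
on-site or the joint (A)-summand of `L` is `≤ s`.  Register `s = 2√6`, `k₀ = 3`; closing path = the finite U-A1 census via `…JammedBall`. -/
def JammedOneSmall (s : ℝ) (k₀ : ℕ) : Prop :=
  ∀ L : EuclideanSpace ℝ (Fin 3) ≃ₗᵢ[ℝ] EuclideanSpace ℝ (Fin 3),
  ∀ X : Finset (EuclideanSpace ℝ (Fin 3)), (∀ p ∈ X, ∀ q ∈ X, p ≠ q → 1 ≤ dist p q) →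
  ∀ z ∈ X, (X.filter fun q => dist z q = 1).card ≤ 11 → ¬ OnSiteAt coaxialModuleUniverse X z → ¬ MonoModuleAt L X z →
    k₀ < (X.filter fun q => dist z q = 1).card → JammedOneAt X z →
    HasDeletionOnSite X z ∨
      localSummandA WordVersion.v2 (basalSystem L)
        (basalSystem (((ℝ ∙ EuclideanSpace.single (2 : Fin 3) (1 : ℝ)).reflection).trans L)) X z ≤ s

open scoped Classical in
/-- **THE SEAM RESIDUAL**: `MultiGrainSmallHigh s k₀` restricted to payer windows with `¬ JammedOneAt X z` — bi-module junctions (U-A3), several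
dust balls, dense junk (`LocalBarlowRigidity`).  Register `s = 2√6`, `k₀ = 3`, under `KissingGap (5/2)` and `KissingClassification (5/2)`. -/
def SeamResidual (s : ℝ) (k₀ : ℕ) : Prop :=
  ∀ L : EuclideanSpace ℝ (Fin 3) ≃ₗᵢ[ℝ] EuclideanSpace ℝ (Fin 3),
  ∀ X : Finset (EuclideanSpace ℝ (Fin 3)), (∀ p ∈ X, ∀ q ∈ X, p ≠ q → 1 ≤ dist p q) →
  ∀ z ∈ X, (X.filter fun q => dist z q = 1).card ≤ 11 → ¬ OnSiteAt coaxialModuleUniverse X z → ¬ MonoModuleAt L X z →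
    k₀ < (X.filter fun q => dist z q = 1).card → ¬ JammedOneAt X z →
    HasDeletionOnSite X z ∨
      localSummandA WordVersion.v2 (basalSystem L)
        (basalSystem (((ℝ ∙ EuclideanSpace.single (2 : Fin 3) (1 : ℝ)).reflection).trans L)) X z ≤ s

/-- **The split is exact (⇐)**: smallness on the U-A1 shape and on the seam residual together give `MultiGrainSmallHigh`. -/
theorem multiGrainSmallHigh_of_jammedOne_of_residual {s : ℝ} {k₀ : ℕ} (hjam : JammedOneSmall s k₀) (hres : SeamResidual s k₀) :
    MultiGrainSmallHigh s k₀ := by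
  intro L X hX z hz hdeg hoff hM hk
  by_cases hJ : JammedOneAt X z
  · exact hjam L X hX z hz hdeg hoff hM hk hJ
  · exact hres L X hX z hz hdeg hoff hM hk hJ

/-- **The split is exact (⇒, U-A1 part).** -/
theorem jammedOneSmall_of_multiGrainSmallHigh {s : ℝ} {k₀ : ℕ} (h : MultiGrainSmallHigh s k₀) : JammedOneSmall s k₀ :=
  fun L X hX z hz hdeg hoff hM hk _ => h L X hX z hz hdeg hoff hM hk

/-- **The split is exact (⇒, residual part).** -/
theorem seamResidual_of_multiGrainSmallHigh {s : ℝ} {k₀ : ℕ} (h : MultiGrainSmallHigh s k₀) : SeamResidual s k₀ :=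
  fun L X hX z hz hdeg hoff hM hk _ => h L X hX z hz hdeg hoff hM hk

/-- `MultiGrainSmallHigh s k₀ ↔ JammedOneSmall s k₀ ∧ SeamResidual s k₀`. -/
theorem multiGrainSmallHigh_iff_jammedOne_and_residual (s : ℝ) (k₀ : ℕ) :
    MultiGrainSmallHigh s k₀ ↔ JammedOneSmall s k₀ ∧ SeamResidual s k₀ :=
  ⟨fun h => ⟨jammedOneSmall_of_multiGrainSmallHigh h, seamResidual_of_multiGrainSmallHigh h⟩,
    fun h => multiGrainSmallHigh_of_jammedOne_of_residual h.1 h.2⟩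

/-- Both halves are monotone in the line. -/
theorem jammedOneSmall_mono {s t : ℝ} {k₀ : ℕ} (hst : s ≤ t) (h : JammedOneSmall s k₀) : JammedOneSmall t k₀ := by
  intro L X hX z hz hdeg hoff hM hk hJ
  rcases h L X hX z hz hdeg hoff hM hk hJ with h' | h'
  · exact Or.inl h'
  · exact Or.inr (h'.trans hst)

/-- Both halves are monotone in the line. -/
theorem seamResidual_mono {s t : ℝ} {k₀ : ℕ} (hst : s ≤ t) (h : SeamResidual s k₀) : SeamResidual t k₀ := by
  intro L X hX z hz hdeg hoff hM hk hJ
  rcases h L X hX z hz hdeg hoff hM hk hJ with h' | h'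
  · exact Or.inl h'
  · exact Or.inr (h'.trans hst)

open scoped Classical in
/-- Unpacking the shape under `¬ OnSiteAt`: the jammed ball lies within distance `3` of the payer (otherwise the two radius-`3` windows coincide). -/
theorem dist_le_three_of_jammedOneAt {X : Finset (EuclideanSpace ℝ (Fin 3))} {z x : EuclideanSpace ℝ (Fin 3)}
    (hoff : ¬ OnSiteAt coaxialModuleUniverse X z) (hsite : OnSiteAt coaxialModuleUniverse (X.erase x) z) : dist z x ≤ 3 := by
  by_contra hfar
  apply hoff
  obtain ⟨P, hP, S, hwin⟩ := hsite
  refine ⟨P, hP, S, ?_⟩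
  rw [← hwin]
  ext y
  simp only [mem_filter, mem_erase]
  constructor
  · rintro ⟨hy, hd⟩
    exact ⟨⟨fun h => hfar (h ▸ hd), hy⟩, hd⟩
  · rintro ⟨⟨-, hy⟩, hd⟩
    exact ⟨hy, hd⟩

end TailResidue

end Summit.Ventures.Crystal3D.Theorems

end
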